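import Summits.QuantumAdvantage.QuantumAdvantage.Theorems.SosSandwichTransferPBTruncatedRuns
import Summits.QuantumAdvantage.QuantumAdvantage.Theorems.SosSandwichTransferPBLayoutFP
import Summits.QuantumAdvantage.QuantumAdvantage.Theorems.SosSandwichTransferPBKeyedUniform
import Literature.Computability.Complexity.CodeFPBudgets
import Literature.Computability.Complexity.CodeFPStringKit
import Literature.Computability.Complexity.CodeFPStrings
import HarnessLib

/-!
# Crux `TransferPB` (stmt-QuantumAdvantage-15238, route SosSandwich), line `birth` — the layout WITH COPIES of the input for the truncated-runs estimator

Obligation (Q) of stub `stub_pbOracleSimulation`. The joint estimator `truncRun F nOf` (`Theorems/…TruncatedRuns.lean`) reads, on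
an instance `z` of length `L`, `M = T(n)+1` input segments `z[b·n,(b+1)·n)` (`n = nOf L`) and the parameter part `z.drop (M·n)`;
its semantics were proved for instances WELL LAID OUT for `(x, ρ, t, pad)`. This file supplies the classical pre-processor
producing such instances from node-test instances `v = ⟨x, ⟨encPath ρ, t⟩⟩`, with the input length decoded from the layout
LENGTH exactly as in `Theorems/…LayoutFP.lean` (`nOfLayout L = L − ⌊√L⌋²`):

* `copies M x = x^M` (`copies_length`, `getD_copies_append`);
* **`layoutC F v = copies (T(|x|)+1) x ++ paramStr v 1^{pad}`** with `s = 2(P + |v| + 2) + ((P − |x|) mod 2)`, `P = (T+1)|x|`,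
  `pad = (s² − (P − |x|) − 2|v| − 4)/2`, so that `|layoutC F v| = |x| + s²` (`length_layoutC_boolPair`) and
  `nOfLayout |layoutC F v| = |x|` (`nOfLayout_layoutC`); `layoutC_mem_FP` (for uniform `F`);
* **well laid out**: for `v = ⟨x, w⟩`, `truncRun_nOf_layoutC` (`(truncRun F nOfLayout).nOf |layoutC F v| = |x|`),
  `inpB_layoutC` (every input segment is a copy of `x`), `drop_layoutC` (the parameter part is `paramStr v 1^{pad}`) — the
  hypotheses `hn`, `hseg`, `hdrop` of `kernelProb_truncRun_full_eq_nodeMean`, `sum_kernelProb_truncRun_query_eq_bbbvMag`,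
  `sum_kernelProb_truncRun_prefix_eq_blockMag`.

All proved; definitions are explicit string functions. No named fact. Sources: E. Bernstein, U. Vazirani, SIAM J. Comput. 26
(1997), §8 (classical pre-processing); S. Arora, B. Barak, Computational Complexity (CUP 2009), §1.3.
-/

-- D-0017: single-conjunct summit ⇒ the duplicate `QuantumAdvantage.QuantumAdvantage` is mandated.
set_option linter.dupNamespace false

noncomputable section

namespace Summit.QuantumAdvantage.QuantumAdvantage.Cruxes.TransferPB.Birth

open Finset Literature.Computability.Cryptography Literature.Computability.Complexity
  Literature.Computability.Complexity.Brick Literature.Computability.Complexity.Plumb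
  Literature.Computability.QuantumComplexity Literature.Computability.QuantumComplexity.ClassicalSimulation
  Literature.Computability.Cryptography.ExplicitKWiseHash
open _root_.Computability CodeFP Polynomial

namespace SimTreePB

/-! ### Copies of a string -/

/-- `x^M`: `M` copies of `x`. [cite: AroraBarak2009, §1.3] -/
def copies (M : ℕ) (x : List Bool) : List Bool := (List.replicate M x).flatten

/-- `|x^M| = M|x|`. [folklore] -/
theorem copies_length (M : ℕ) (x : List Bool) : (copies M x).length = M * x.length := by
  simp [copies, List.length_flatten, List.sum_replicate]

/-- `x^{M+1} = x ++ x^M`. [folklore] -/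
theorem copies_succ (M : ℕ) (x : List Bool) : copies (M + 1) x = x ++ copies M x := by
  simp [copies, List.replicate_succ]

/-- Reading position `b|x| + i` (`b < M`, `i < |x|`) of `x^M ++ r` gives `x[i]`. [folklore] -/
theorem getD_copies_append (x r : List Bool) : ∀ (M b i : ℕ), b < M → i < x.length →
    (copies M x ++ r).getD (b * x.length + i) false = x.getD i false
  | 0, b, i, hb, _ => absurd hb (Nat.not_lt_zero b)
  | M + 1, 0, i, _, hi => by
    rw [copies_succ, List.append_assoc, Nat.zero_mul, Nat.zero_add, List.getD_eq_getElem?_getD,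
      List.getElem?_append_left hi, ← List.getD_eq_getElem?_getD]
  | M + 1, b + 1, i, hb, hi => by
    rw [copies_succ, List.append_assoc, List.getD_eq_getElem?_getD,
      List.getElem?_append_right (by rw [Nat.succ_mul]; omega)]
    have h := getD_copies_append x r M b i (by omega) hi
    rw [List.getD_eq_getElem?_getD] at h
    have e : (b + 1) * x.length + i - x.length = b * x.length + i := by rw [Nat.succ_mul]; omega
    rw [e, h]

/-- Copies on codes: `(x, 1^M) ↦ x^M`. [cite: AroraBarak2009, §1.3] -/
theorem copiesC : CodeFP (pairE strE unE) strE (fun p => copies p.2 p.1) :=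
  (strFlatten.comp (replicateOf strE)).congr fun _ => rfl

/-! ### The padding arithmetic -/

variable (F : QCircuitFamily cliffordT)

/-- The number of blocks `M = T(n) + 1`. [cite: BennettBernsteinBrassardVazirani1997, Cor. 3.4 (proof)] -/
def blocksOf (n : ℕ) : ℕ := (F.circ n).oracleQueries + 1

/-- The side of the square: `s = 2(P + |v| + 2) + ((P − n) mod 2)`, `P = M·n`. [folklore] -/
def sideC (n lv : ℕ) : ℕ := 2 * (blocksOf F n * n + lv + 2) + (blocksOf F n * n - n) % 2

/-- The padding length: `(s² − (P − n) − 2|v| − 4)/2`. [folklore] -/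
def padC (n lv : ℕ) : ℕ := (sideC F n lv * sideC F n lv - (blocksOf F n * n - n) - 2 * lv - 4) / 2

/-- **The padding equation**: `P + 2|v| + 2·pad + 4 = n + s²`, together with `P ≤ n + s²` and `n ≤ s`. [folklore] -/
theorem padC_spec (n lv : ℕ) :
    blocksOf F n * n + 2 * lv + 2 * padC F n lv + 4 = n + sideC F n lv ^ 2 ∧
      blocksOf F n * n ≤ n + sideC F n lv ^ 2 ∧ n ≤ sideC F n lv := by
  have hM : 1 ≤ blocksOf F n := Nat.le_add_left 1 _
  have hP : n ≤ blocksOf F n * n := Nat.le_mul_of_pos_left n hM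
  generalize hPdef : blocksOf F n * n = P at hP ⊢
  have hs : sideC F n lv = 2 * (P + lv + 2) + (P - n) % 2 := by rw [sideC, hPdef]
  generalize hsdef : sideC F n lv = s at hs ⊢
  have hQpar : (s * s) % 2 = s % 2 := by
    rcases Nat.mod_two_eq_zero_or_one s with h | h
    · rw [h]; exact Nat.mul_mod _ _ 2 ▸ by simp [h]
    · rw [h]; exact Nat.mul_mod _ _ 2 ▸ by simp [h]
  have hQge : s ≤ s * s := Nat.le_mul_self s
  have hpad : padC F n lv = (s * s - (P - n) - 2 * lv - 4) / 2 := by rw [padC, hsdef, hPdef]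
  rw [hpad, sq]
  generalize s * s = Q at hQpar hQge ⊢
  omega

/-! ### The layout -/

/-- **The layout with copies**: `v = ⟨x, w⟩ ↦ x^{T(|x|)+1} ++ paramStr v 1^{pad}`.
[cite: BernsteinVazirani1997, §8] [cite: AroraBarak2009, §1.3] -/
def layoutC (v : List Bool) : List Bool :=
  copies (blocksOf F (fstF v).length) (fstF v) ++ paramStr v (ones (padC F (fstF v).length v.length))

/-- Length of a parameter string. [folklore] -/
theorem length_paramStr (v pad : List Bool) : (paramStr v pad).length = 2 * v.length + 2 * pad.length + 4 := by
  simp only [paramStr, length_boolPair, List.length_nil]; omega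

/-- **Length of the layout of `⟨x, w⟩`**: `|x| + s²`. [folklore] -/
theorem length_layoutC_boolPair (x w : List Bool) :
    (layoutC F (boolPair x w)).length = x.length + sideC F x.length (boolPair x w).length ^ 2 := by
  have h := (padC_spec F x.length (boolPair x w).length).1
  rw [layoutC, List.length_append, copies_length, fstF_boolPair, length_paramStr]
  simp only [ones, List.length_replicate]
  omega

/-- **The layout length determines `|x|`.** [folklore] -/
theorem nOfLayout_layoutC (x w : List Bool) : nOfLayout (layoutC F (boolPair x w)).length = x.length := by
  rw [length_layoutC_boolPair, nOfLayout_add_sq (padC_spec F x.length (boolPair x w).length).2.2]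

variable {F} in
/-- **The layout is polynomial time**, for a uniform `F`. [cite: AroraBarak2009, §1.3] -/
theorem layoutC_mem_FP (hF : F.IsUniform) : layoutC F ∈ FP := by
  have unMul : CodeFP (pairE unE unE) unE (fun p => p.1 * p.2) :=
    ((ulength unitE).comp (unitsMul.comp ((replicateUnit.comp (fst _ _)).pair (replicateUnit.comp (snd _ _))))).congr
      fun p => by simp
  have cV : CodeFP strE strE (fun v => v) := CodeFP.id strE
  have cX : CodeFP strE strE fstF := ⟨fstF, fstF_mem_FP, fun _ => rfl⟩
  have cN : CodeFP strE unE (fun v => (fstF v).length) := strLength.comp cX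
  have cM : CodeFP strE unE (fun v => blocksOf F (fstF v).length) :=
    (unSucc.comp ((codeFP_oracleQueries_un F hF).comp cN)).congr fun _ => rfl
  have cP : CodeFP strE unE (fun v => blocksOf F (fstF v).length * (fstF v).length) := unMul.comp (cM.pair cN)
  have cLv : CodeFP strE unE (fun v => v.length) := strLength
  have hpar : ∀ v : List Bool, min ((blocksOf F (fstF v).length * (fstF v).length - (fstF v).length) % 2) 1 =
      (blocksOf F (fstF v).length * (fstF v).length - (fstF v).length) % 2 := fun v =>
    min_eq_left (Nat.lt_succ_iff.1 (Nat.mod_lt _ (Nat.succ_pos 1)))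
  have cPar : CodeFP strE unE (fun v => (blocksOf F (fstF v).length * (fstF v).length - (fstF v).length) % 2) :=
    (unOfNatMin.comp ((const _ 1).pair (natMod.comp ((natSub.comp ((natOfUn.comp cP).pair (natOfUn.comp cN))).pair
      (const _ 2))))).congr fun v => hpar v
  have cS : CodeFP strE unE (fun v => sideC F (fstF v).length v.length) :=
    (unAdd.comp (((unMulConst 2).comp (unAdd.comp ((unAdd.comp (cP.pair cLv)).pair (const _ 2)))).pair cPar)).congr
      fun _ => rfl
  have cQ : CodeFP strE unE (fun v => sideC F (fstF v).length v.length * sideC F (fstF v).length v.length) :=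
    unMul.comp (cS.pair cS)
  have cPn : CodeFP strE natE (fun v => blocksOf F (fstF v).length * (fstF v).length - (fstF v).length) :=
    natSub.comp ((natOfUn.comp cP).pair (natOfUn.comp cN))
  have cA : CodeFP strE natE (fun v => sideC F (fstF v).length v.length * sideC F (fstF v).length v.length -
      (blocksOf F (fstF v).length * (fstF v).length - (fstF v).length)) := natSub.comp ((natOfUn.comp cQ).pair cPn)
  have cB : CodeFP strE natE (fun v => sideC F (fstF v).length v.length * sideC F (fstF v).length v.length -
      (blocksOf F (fstF v).length * (fstF v).length - (fstF v).length) - 2 * v.length) :=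
    natSub.comp (cA.pair (natOfUn.comp ((unMulConst 2).comp cLv)))
  have cC : CodeFP strE natE (fun v => sideC F (fstF v).length v.length * sideC F (fstF v).length v.length -
      (blocksOf F (fstF v).length * (fstF v).length - (fstF v).length) - 2 * v.length - 4) :=
    natSub.comp (cB.pair (const _ 4))
  have cPadN : CodeFP strE natE (fun v => padC F (fstF v).length v.length) :=
    (natDiv.comp (cC.pair (const _ 2))).congr fun v => rfl
  have cPad : CodeFP strE unE (fun v => padC F (fstF v).length v.length) :=
    (unOfNatMin.comp (cQ.pair cPadN)).congr fun v => by
      refine min_eq_left ?_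
      rw [padC]
      exact (Nat.div_le_self _ _).trans (by omega)
  have cCopies : CodeFP strE strE (fun v => copies (blocksOf F (fstF v).length) (fstF v)) := copiesC.comp (cX.pair cM)
  have cParam : CodeFP strE strE (fun v => paramStr v (ones (padC F (fstF v).length v.length))) :=
    (cV.pair (cPad.pair (const strE (eβ := strE) ([] : List Bool)))).recodeOut fun v => by
      rw [pairE_apply, pairE_apply, unE_eq_ones]; rfl
  obtain ⟨f, hf, hfv⟩ := strAppend.comp (cCopies.pair cParam)
  refine (show layoutC F = f from funext fun v => ?_) ▸ hf
  exact (hfv v).symm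

/-! ### The layout is well laid out for the truncated-runs estimator -/

/-- **The estimator's input length on the layout is `|x|`** (the segments fit, so no clipping). [folklore] -/
theorem truncRun_nOf_layoutC (x w : List Bool) :
    (truncRun F nOfLayout).nOf (layoutC F (boolPair x w)).length = x.length := by
  show KeyedBlocks.truncNOf F nOfLayout (layoutC F (boolPair x w)).length = x.length
  rw [KeyedBlocks.truncNOf, nOfLayout_layoutC]
  rw [if_pos]
  rw [length_layoutC_boolPair]
  exact (padC_spec F x.length (boolPair x w).length).2.1

/-- The number of blocks on the layout is `T(|x|) + 1`. [folklore] -/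
theorem truncRun_MOf_layoutC (x w : List Bool) :
    (truncRun F nOfLayout).MOf (layoutC F (boolPair x w)).length = blocksOf F x.length := by
  rw [KeyedBlocks.trunc_MOf, truncRun_nOf_layoutC]; rfl

/-- **Every input segment of the layout is a copy of `x`.** [folklore] -/
theorem inpB_layoutC (x w : List Bool) (b : Fin ((truncRun F nOfLayout).MOf (layoutC F (boolPair x w)).length)) :
    (truncRun F nOfLayout).inpB (layoutC F (boolPair x w)) b =
      fun i : Fin ((truncRun F nOfLayout).nOf (layoutC F (boolPair x w)).length) => x.getD (i : ℕ) false := by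
  funext i
  obtain ⟨bv, hbv⟩ := b
  obtain ⟨iv, hiv⟩ := i
  have hn := truncRun_nOf_layoutC F x w
  have hb : bv < blocksOf F x.length := by rw [← truncRun_MOf_layoutC F x w]; exact hbv
  have hi : iv < x.length := by rw [← hn]; exact hiv
  have hn' : KeyedBlocks.truncNOf F nOfLayout (layoutC F (boolPair x w)).length = x.length := hn
  dsimp only [KeyedBlocks.inpB]
  rw [List.get_eq_getElem, ← List.getD_eq_getElem _ false]
  dsimp only
  rw [hn', layoutC, fstF_boolPair]
  exact getD_copies_append x _ _ bv iv hb hi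

/-- **The parameter part of the layout is `paramStr v 1^{pad}`.** [folklore] -/
theorem drop_layoutC (x w : List Bool) :
    (layoutC F (boolPair x w)).drop ((truncRun F nOfLayout).MOf (layoutC F (boolPair x w)).length *
        (truncRun F nOfLayout).nOf (layoutC F (boolPair x w)).length) =
      paramStr (boolPair x w) (ones (padC F x.length (boolPair x w).length)) := by
  rw [truncRun_MOf_layoutC, truncRun_nOf_layoutC, layoutC, fstF_boolPair]
  exact List.drop_left' (copies_length _ _)

end SimTreePB

end Summit.QuantumAdvantage.QuantumAdvantage.Cruxes.TransferPB.Birth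

end
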